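import Literature.NumberTheory.EllipticCurves.MatsunoCurvesRank
import Literature.NumberTheory.EllipticCurves.KramerCurvesPadic
import Literature.NumberTheory.EllipticCurves.KodairaNeron
import Literature.NumberTheory.EllipticCurves.LocalIndexBadPoints
import Literature.NumberTheory.EllipticCurves.TamagawaSubgroupProofs
import Literature.NumberTheory.EllipticCurves.KodairaNeronSplitHenselianProofs
import HarnessLib

/-!
# Matsuno 2009, Corollary 5.6: the local leaf from the Kodaira–Néron theorem (proof)

`Proofs` companion of `Literature/NumberTheory/EllipticCurves/MatsunoCurvesRank.lean` for its
named fact `Literature.NumberTheory.EllipticCurves.Matsuno2009_curveA_tamagawa` (K. Matsuno,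
Math. Res. Lett. 16 (2009), p. 458, first sentence of the proof of Corollary 5.6: "If `m_j` does
not divide `st`, then the Tamagawa factor of `A` at `m_j` is equal to `2n`, i.e.,
`m_j ∈ T_{A,K}`", with "both `A` and `B` have split multiplicative reduction at `q`").

This file PROVES that fact from the tree's named fact
`WeierstrassCurve.index_goodReductionSubgroup_of_hasSplitMultiplicativeReduction` (`KodairaNeron`:
Silverman *ATAEC* Cor. IV.9.2(d) with (b) — over a henselian discrete valuation ring with perfect
residue field, a minimal equation with split multiplicative reduction has `E(K)/E₀(K)` cyclic of
order `v(Δ)`), taken at `R = ℤ_q` (complete, hence henselian; residue field `𝔽_q`), everything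
specific to Kramer's curve being proved: `A = A_m`, `m = t m₁ⁿ⋯m_kⁿ`, has split multiplicative
reduction at every prime `q ∣ m` and its equation is `ℤ_q`-minimal (`KramerCurvesPadic`), the
local Tamagawa number of a minimal equation is the index of ITS `E₀`
(`WeierstrassCurve.localTamagawaNumber_eq_index_goodReductionSubgroup`, from the tree's
model-independence of the index), the valuation of a natural number in `ℚ_q` is
`exp(−ord_q)` (`valuation_maximalIdeal_natCast`), and for `q = m_j ∤ st`,
`ord_q(Δ_A) = ord_q(l²m²) = 2 ord_q(m) = 2n` (`MatsunoParams.padicValNat_m_bigM`,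
`MatsunoParams.not_m_dvd_bigL`). Consequently the trust base of the barrier fact
`Matsuno2009_thmA` may cite the Kodaira–Néron theorem in place of the paper-specific local leaf
(`Matsuno2009_curveA_tamagawa_of_kodairaNeron`; assembled on the barrier side).

**Discharge (appended).** The order half of the Kodaira–Néron fact — `[E(K) : E₀(K)] = v(Δ)`
for a minimal split multiplicative equation over a Henselian discrete valuation ring, without the
cyclicity — is PROVED in the tree
(`WeierstrassCurve.index_goodReductionSubgroup_eq_of_hasSplitMultiplicativeReduction`,
`KodairaNeronSplitHenselianProofs.lean`), and it is all the argument above uses; hence the named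
fact holds outright: `Matsuno2009_curveA_tamagawa_holds`.

## References

* [Matsuno2009] K. Matsuno, Math. Res. Lett. 16 (2009), 449–461, proof of Cor. 5.6 (p. 458).
* [SilvermanATAEC1994] J. H. Silverman, *Advanced Topics*, Cor. IV.9.2(b),(d).
* [SilvermanAEC2009] J. H. Silverman, *AEC*, VII.1 Prop. 1.3(b), VII.6 Ex. 7.6.
-/

noncomputable section

open scoped Classical NumberField

open IsLocalRing IsDiscreteValuationRing IsDedekindDomain.HeightOneSpectrum

/-! ### The local Tamagawa number of a minimal equation is the index of its own `E₀` -/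

namespace WeierstrassCurve

section DVR

variable (R : Type*) [CommRing R] [IsDomain R] [IsDiscreteValuationRing R]
  {K : Type*} [Field K] [Algebra R K] [IsFractionRing R K]

/-- The index `[E(K) : E₀(K)]` only depends on the (minimal) equation through the equation: equal
equations give equal indices (`IsMinimal` is a proposition). [folklore] -/
theorem index_goodReductionSubgroup_congr {X Y : WeierstrassCurve K} [X.IsMinimal R]
    [Y.IsMinimal R] (h : X = Y) :
    (X.goodReductionSubgroup R).index = (Y.goodReductionSubgroup R).index := by
  subst h
  rfl

/-- **For a minimal equation, `c = [E(K) : E₀(K)]` may be computed on the equation itself**: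
`W.localTamagawaNumber R` is by definition the index for Mathlib's chosen minimal model
`W.minimal R = C • W`; when `W` is itself minimal (and `Δ ≠ 0`), `C` has `v(u) = 1`
(`valuation_u_eq_one_of_isMinimal_of_eq_smul`), hence comes from a change of variables over `R`
(`exists_variableChange_map_eq_of_isIntegral`, Silverman *AEC* VII.1.3(b)), and the index is the
same for all `R`-models (`LocalIndex.index_nonsingularReductionSubgroup_smul`, with the bridge
`goodReductionSubgroup_baseChange_eq`). (Dot-notation extension of Mathlib's `WeierstrassCurve`.)
[cite: SilvermanAEC2009, VII.1 Prop. 1.3(b) and VII.6 Ex. 7.6] -/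
theorem localTamagawaNumber_eq_index_goodReductionSubgroup (W : WeierstrassCurve K)
    [W.IsElliptic] [W.IsMinimal R] :
    W.localTamagawaNumber R = (W.goodReductionSubgroup R).index := by
  obtain ⟨I₀, rfl⟩ : ∃ I₀ : WeierstrassCurve R, W = I₀.baseChange K := IsIntegral.integral
  set W := I₀.baseChange K with hW
  set C := (W.exists_isMinimal R).choose with hC
  have hmin : W.minimal R = C • W := rfl
  have hu := valuation_u_eq_one_of_isMinimal_of_eq_smul R hmin W.isUnit_Δ.ne_zero
  haveI : IsIntegral R (C • W) := hmin ▸ inferInstance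
  obtain ⟨D, hD⟩ := exists_variableChange_map_eq_of_isIntegral R W C hu
  have hmin' : W.minimal R = (D • I₀).baseChange K := by
    rw [hmin, ← hD, hW, Literature.NumberTheory.EllipticCurves.LocalIndex.baseChange_smul_eq]
  haveI : ((D • I₀).baseChange K).IsMinimal R := hmin' ▸ inferInstance
  change ((W.minimal R).goodReductionSubgroup R).index = _
  rw [index_goodReductionSubgroup_congr R hmin', goodReductionSubgroup_baseChange_eq,
    Literature.NumberTheory.EllipticCurves.LocalIndex.index_nonsingularReductionSubgroup_smul,
    ← goodReductionSubgroup_baseChange_eq]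

end DVR

end WeierstrassCurve

namespace Literature.NumberTheory.EllipticCurves

open Finset WeierstrassCurve

/-! ### Valuations at `q`: naturals in `ℚ_q`, and `m`, `l` at the `m_j` -/

/-- `ord_q` of a finite product of non-zero naturals is the sum of the `ord_q`. [folklore] -/
theorem padicValNat_finset_prod {ι : Type*} (q : ℕ) [Fact q.Prime] (s : Finset ι) (f : ι → ℕ)
    (hf : ∀ i ∈ s, f i ≠ 0) : padicValNat q (∏ i ∈ s, f i) = ∑ i ∈ s, padicValNat q (f i) := by
  induction s using Finset.induction_on with
  | empty => simp
  | insert a s ha ih =>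
    rw [Finset.prod_insert ha, Finset.sum_insert ha,
      padicValNat.mul (hf a (Finset.mem_insert_self a s))
        (Finset.prod_ne_zero_iff.mpr fun i hi => hf i (Finset.mem_insert_of_mem hi)),
      ih fun i hi => hf i (Finset.mem_insert_of_mem hi)]

/-- A natural number prime to `q` is a unit of `ℤ_q`, i.e. lies outside the maximal ideal.
[folklore] -/
theorem natCast_not_mem_maximalIdeal_padicInt {q : ℕ} [Fact q.Prime] {N : ℕ} (h : ¬ q ∣ N) :
    (N : ℤ_[q]) ∉ IsLocalRing.maximalIdeal ℤ_[q] := by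
  rw [IsLocalRing.mem_maximalIdeal, PadicInt.mem_nonunits, ← Int.cast_natCast,
    PadicInt.norm_int_lt_one_iff_dvd, Int.natCast_dvd_natCast]
  exact h

/-- **The valuation of a natural number in `ℚ_q`**: for `N ≠ 0`, the adic valuation of the maximal
ideal of `ℤ_q` (the valuation of Mathlib's reduction theory) takes the value `exp(−ord_q N)` on
`N` (`N = q^{ord_q N} N'` with `q ∤ N'`, `q` a uniformiser, `N'` a unit). [folklore] -/
theorem valuation_maximalIdeal_natCast {q : ℕ} [Fact q.Prime] {N : ℕ} (hN : N ≠ 0) :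
    (IsDiscreteValuationRing.maximalIdeal ℤ_[q]).valuation ℚ_[q] (N : ℚ_[q]) =
      WithZero.exp (-(padicValNat q N : ℤ)) := by
  have hq : (q : ℤ_[q]) ≠ 0 := by exact_mod_cast (Fact.out : q.Prime).ne_zero
  set v := IsDiscreteValuationRing.maximalIdeal ℤ_[q] with hv
  -- `q` is a uniformiser
  have hvq : v.intValuation (q : ℤ_[q]) = WithZero.exp (-1 : ℤ) :=
    v.intValuation_singleton hq (by
      rw [hv]; exact PadicInt.maximalIdeal_eq_span_p)
  -- `N = q^a N'`, `q ∤ N'`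
  set a := N.factorization q with ha
  have hdecomp : q ^ a * (N / q ^ a) = N := Nat.ordProj_mul_ordCompl_eq_self N q
  have hN' : ¬ q ∣ N / q ^ a := Nat.not_dvd_ordCompl (Fact.out : q.Prime) hN
  have hcast : (N : ℚ_[q]) = algebraMap ℤ_[q] ℚ_[q] ((q : ℤ_[q]) ^ a * ((N / q ^ a : ℕ) : ℤ_[q])) := by
    rw [map_mul, map_pow, map_natCast, map_natCast]
    exact_mod_cast hdecomp.symm
  rw [hcast, valuation_of_algebraMap, map_mul, map_pow, hvq,
    intValuation_eq_one_iff.mpr (natCast_not_mem_maximalIdeal_padicInt hN'), mul_one,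
    ← WithZero.exp_nsmul, ha, Nat.factorization_def N (Fact.out : q.Prime)]
  simp

namespace MatsunoParams

variable {K : Type*} [Field K] [NumberField K] {n k : ℕ}

/-- If there is an index `j` at all then `n ≥ 1` ((A2): `m_j ∤ n`, while everything divides
`0`). [folklore] -/
theorem pos_n (P : MatsunoParams K n k) (j : Fin k) : 0 < n := by
  rcases Nat.eq_zero_or_pos n with h | h
  · exact absurd (h ▸ dvd_zero (P.m j)) (P.not_m_dvd j)
  · exact h

/-- `m_j ∣ m = t m₁ⁿ⋯m_kⁿ` (`n ≥ 1`). [cite: Matsuno2009, §5 (p. 456)] -/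
theorem m_dvd_bigM (P : MatsunoParams K n k) (j : Fin k) : P.m j ∣ P.bigM :=
  dvd_mul_of_dvd_right ((dvd_pow_self _ (P.pos_n j).ne').trans
    (Finset.dvd_prod_of_mem (fun i => P.m i ^ n) (Finset.mem_univ j))) _

/-- **`ord_{m_j}(m) = n` when `m_j ∤ st`**: `m = t m₁ⁿ⋯m_kⁿ` with the `m_i` distinct primes and
`m_j ∤ t`. [cite: Matsuno2009, proof of Corollary 5.6 (p. 458)] -/
theorem padicValNat_m_bigM (P : MatsunoParams K n k) (j : Fin k) (hj : ¬ P.m j ∣ P.s * P.t) :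
    padicValNat (P.m j) P.bigM = n := by
  haveI : Fact (P.m j).Prime := ⟨P.prime_m j⟩
  have ht : ¬ P.m j ∣ P.t := fun h => hj (dvd_mul_of_dvd_right h _)
  have hprod : (∏ i, P.m i ^ n) ≠ 0 :=
    Finset.prod_ne_zero_iff.mpr fun i _ => pow_ne_zero _ (P.prime_m i).ne_zero
  unfold bigM
  rw [padicValNat.mul P.t_pos.ne' hprod, padicValNat.eq_zero_of_not_dvd ht, zero_add,
    padicValNat_finset_prod _ _ _ fun i _ => pow_ne_zero _ (P.prime_m i).ne_zero]
  simp_rw [padicValNat.pow]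
  rw [Finset.sum_eq_single j]
  · rw [padicValNat_self, mul_one]
  · intro i _ hij
    haveI : Fact (P.m i).Prime := ⟨P.prime_m i⟩
    rw [padicValNat_primes fun h => hij (P.injective_m h.symm), mul_zero]
  · intro h
    exact absurd (Finset.mem_univ j) h

/-- **`m_j ∤ l`**: `l = 16m + 1` and `m_j ∣ m`. [cite: Matsuno2009, §5 (p. 456)] -/
theorem not_m_dvd_bigL (P : MatsunoParams K n k) (j : Fin k) : ¬ P.m j ∣ P.bigL := by
  rw [P.bigL_eq]
  intro h
  have h16 : P.m j ∣ 16 * P.bigM := dvd_mul_of_dvd_right (P.m_dvd_bigM j) 16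
  have h1 : P.m j ∣ 1 := (Nat.dvd_add_right h16).mp h
  exact (P.prime_m j).one_lt.ne' (Nat.dvd_one.mp h1)

/-- `l ≠ 0`. [folklore] -/
theorem bigL_ne_zero (P : MatsunoParams K n k) : P.bigL ≠ 0 := by
  rw [P.bigL_eq]; exact Nat.succ_ne_zero _

/-- **`ord_{m_j}(Δ_A) = 2n` for `m_j ∤ st`**: `Δ_A = l²m²` over `ℚ_{m_j}` has valuation
`exp(−2n)`. [cite: Matsuno2009, proof of Corollary 5.6 (p. 458)] -/
theorem valuation_Δ_curveA_padic (P : MatsunoParams K n k) (j : Fin k)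
    (hj : ¬ P.m j ∣ P.s * P.t) [Fact (P.m j).Prime] :
    (IsDiscreteValuationRing.maximalIdeal ℤ_[P.m j]).valuation ℚ_[P.m j]
        (kramerCurveA ((P.bigM : ℤ) : ℚ_[P.m j])).Δ = WithZero.exp (-(2 * n : ℤ)) := by
  have hΔ : (kramerCurveA ((P.bigM : ℤ) : ℚ_[P.m j])).Δ =
      ((P.bigM ^ 2 * P.bigL ^ 2 : ℕ) : ℚ_[P.m j]) := by
    rw [kramerCurveA_Δ, P.bigL_eq]; push_cast; ring
  rw [hΔ, valuation_maximalIdeal_natCast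
      (Nat.mul_ne_zero (pow_ne_zero _ P.bigM_ne_zero) (pow_ne_zero _ P.bigL_ne_zero)),
    padicValNat.mul (pow_ne_zero _ P.bigM_ne_zero) (pow_ne_zero _ P.bigL_ne_zero),
    padicValNat.pow, padicValNat.pow, P.padicValNat_m_bigM j hj,
    padicValNat.eq_zero_of_not_dvd (P.not_m_dvd_bigL j), mul_zero, add_zero]
  push_cast
  ring_nf

end MatsunoParams

/-! ### The leaf from the Kodaira–Néron theorem -/

/-- **`Matsuno2009_curveA_tamagawa` from the Kodaira–Néron theorem** (Silverman *ATAEC*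
Cor. IV.9.2(d) with (b), the tree's named fact
`WeierstrassCurve.index_goodReductionSubgroup_of_hasSplitMultiplicativeReduction`, needed here only
over the rings `ℤ_q`, which are complete — hence henselian, `IsAdicComplete.henselianRing` — with
finite, hence perfect, residue field `𝔽_q`). For Matsuno's parameters and `q = m_j ∤ st`:
`A = A_m` has split multiplicative reduction at `q ∣ m` (proved,
`hasSplitMultiplicativeReductionAtPrime_kramerCurveA`); its equation over `ℚ_q` is minimal with
split multiplicative reduction (`hasSplitMultiplicativeReduction_kramerCurveA_padic`), so
Kodaira–Néron gives `v(Δ_A) = exp(−[A(ℚ_q) : A₀(ℚ_q)])`, while `v(Δ_A) = exp(−2n)`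
(`MatsunoParams.valuation_Δ_curveA_padic`); the index is the local Tamagawa number
(`localTamagawaNumber_eq_index_goodReductionSubgroup`). This is the printed "the Tamagawa factor
of `A` at `m_j` is equal to `2n`". [cite: Matsuno2009, proof of Corollary 5.6 (p. 458, first sentence)] -/
theorem Matsuno2009_curveA_tamagawa_of_kodairaNeron
    (hKN : ∀ (p : ℕ) [Fact p.Prime] (E : WeierstrassCurve ℚ_[p]),
      E.index_goodReductionSubgroup_of_hasSplitMultiplicativeReduction ℤ_[p]) :
    Matsuno2009_curveA_tamagawa := by
  intro K _ _ n k P j hj _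
  have hqm : ((P.m j : ℕ) : ℤ) ∣ (P.bigM : ℤ) := by exact_mod_cast P.m_dvd_bigM j
  refine ⟨?_, ?_⟩
  · rw [P.curveA_eq]
    exact hasSplitMultiplicativeReductionAtPrime_kramerCurveA P.bigM_int_ne_zero hqm
  · haveI hE : (P.curveA.baseChange ℚ_[P.m j]).IsElliptic := by
      haveI := P.isElliptic_curveA
      exact inferInstanceAs (P.curveA.map (algebraMap ℚ ℚ_[P.m j])).IsElliptic
    have hX : P.curveA.baseChange ℚ_[P.m j] = kramerCurveA (((P.bigM : ℤ) : ℚ_[P.m j])) := by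
      rw [P.curveA_eq, baseChange_padic_kramerCurveA_rat]
    rw [hX] at hE ⊢
    haveI hsplit := hasSplitMultiplicativeReduction_kramerCurveA_padic (q := P.m j) hqm
    -- `ℤ_q` is henselian (complete) with perfect (finite) residue field
    haveI : Finite (ResidueField ℤ_[P.m j]) :=
      Finite.of_equiv (ZMod (P.m j)) (PadicInt.residueField (p := P.m j)).symm.toEquiv
    obtain ⟨-, hval⟩ := hKN (P.m j) (kramerCurveA ((P.bigM : ℤ) : ℚ_[P.m j]))
    rw [P.valuation_Δ_curveA_padic j hj, WithZero.exp_inj, neg_inj] at hval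
    rw [WeierstrassCurve.localTamagawaNumber_eq_index_goodReductionSubgroup]
    exact_mod_cast hval.symm

/-- **Matsuno 2009, the local input of Corollary 5.6, PROVED**: for Matsuno's parameters and
`q = m_j ∤ st`, the curve `A` of (5) has split multiplicative reduction at `q` and Tamagawa factor
`c_q(A) = 2n` (p. 458, first sentence of the proof of Corollary 5.6).  Same argument as
`Matsuno2009_curveA_tamagawa_of_kodairaNeron`, with the Kodaira–Néron input replaced by the
tree's theorem `WeierstrassCurve.index_goodReductionSubgroup_eq_of_hasSplitMultiplicativeReduction`
(`[E(ℚ_q) : E₀(ℚ_q)] = ord_q(Δ)` for the `ℤ_q`-minimal split multiplicative equation of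
`A/ℚ_q`; `ℤ_q` is complete, hence Henselian).
[cite: Matsuno2009, proof of Corollary 5.6 (p. 458, first sentence)] -/
theorem Matsuno2009_curveA_tamagawa_holds : Matsuno2009_curveA_tamagawa := by
  intro K _ _ n k P j hj _
  have hqm : ((P.m j : ℕ) : ℤ) ∣ (P.bigM : ℤ) := by exact_mod_cast P.m_dvd_bigM j
  refine ⟨?_, ?_⟩
  · rw [P.curveA_eq]
    exact hasSplitMultiplicativeReductionAtPrime_kramerCurveA P.bigM_int_ne_zero hqm
  · haveI hE : (P.curveA.baseChange ℚ_[P.m j]).IsElliptic := by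
      haveI := P.isElliptic_curveA
      exact inferInstanceAs (P.curveA.map (algebraMap ℚ ℚ_[P.m j])).IsElliptic
    have hX : P.curveA.baseChange ℚ_[P.m j] = kramerCurveA (((P.bigM : ℤ) : ℚ_[P.m j])) := by
      rw [P.curveA_eq, baseChange_padic_kramerCurveA_rat]
    rw [hX] at hE ⊢
    haveI hsplit := hasSplitMultiplicativeReduction_kramerCurveA_padic (q := P.m j) hqm
    obtain ⟨-, hval⟩ := (kramerCurveA ((P.bigM : ℤ) : ℚ_[P.m j])
      ).index_goodReductionSubgroup_eq_of_hasSplitMultiplicativeReduction ℤ_[P.m j]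
    rw [P.valuation_Δ_curveA_padic j hj, WithZero.exp_inj, neg_inj] at hval
    rw [WeierstrassCurve.localTamagawaNumber_eq_index_goodReductionSubgroup]
    exact_mod_cast hval.symm

end Literature.NumberTheory.EllipticCurves

end
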